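import Mathlib.LinearAlgebra.Matrix.DotProduct
import Mathlib.LinearAlgebra.Matrix.Symmetric
import Mathlib.Data.Real.Basic
import Mathlib.Tactic.Linarith
import Mathlib.Tactic.FieldSimp
import Mathlib.Tactic.Abel
import Mathlib.Tactic.Module
import Mathlib.Tactic.Ring
import HarnessLib

/-!
# The negative eigenline of a symmetric `3 × 3` matrix of signature `(2, 1)`

Topic `Analysis/Matrix`; namespace `Literature.Analysis.Matrix`.  Theorems only; no named fact,
no `sorry`.  Pointwise linear algebra for a real symmetric `3 × 3` matrix `T` given with a unit
eigenvector `n` of eigenvalue `λ < 0` such that `T` is positive definite on `n^⊥` — the signature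
`(2, 1)` situation of the normal quadratic form of a near-symplectic form along a zero circle
(Perutz 2006, §2.3 (c)–(d): eigenline `L⁻`; Honda 2004, Thm. 5).  In this situation:

* `dotProduct_mulVec_comm_of_isSymm` — `⟨v, T w⟩ = ⟨w, T v⟩`;
* `quadratic_split` — `⟨m, T m⟩ = ⟨m, n⟩² λ + ⟨v, T v⟩` for the component `v = m - ⟨m, n⟩ n ⊥ n`;
* `dotProduct_ne_zero_of_quadratic_neg` — a NEGATIVE vector has a non-zero component along `n`;
* `eq_smul_of_mulVec_eq_smul_of_neg` — a non-zero eigenvector of negative eigenvalue is a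
  multiple of `n` (and its eigenvalue is `λ`): the negative eigenline is well defined;
* `linearization_injective` — the linearisation `(h, η) ↦ ((T - λ) h - η n, ⟨n, h⟩)` of the
  eigenvector equation `(T v - μ v, |v|²)` at `(n, λ)` is injective (simplicity of `λ`), the
  non-degeneracy input of the implicit function theorem;
* `exists_signed_negative_eigenvector`, `signed_negative_eigenvector_unique` — for a negative
  vector `w` there is EXACTLY ONE unit eigenvector `n'` of negative eigenvalue with `⟨n', w⟩ > 0`.

Vectors are `Fin 3 → ℝ` with Mathlib's `dotProduct`/`mulVec`.

## References

* T. Perutz, *Zero-sets of near-symplectic forms*, J. Symplectic Geom. 4 (2006), §2.3. [Perutz2006]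
* K. Honda, *Local properties of self-dual harmonic 2-forms on a 4-manifold*,
  J. reine angew. Math. 577 (2004), Thm. 5. [Honda2004LocalSD]
-/

namespace Literature.Analysis.Matrix

open _root_.Matrix

variable {T : Matrix (Fin 3) (Fin 3) ℝ} {n : Fin 3 → ℝ} {lam : ℝ}

/-! ### Symmetry -/

/-- `⟨v, T w⟩ = ⟨w, T v⟩` for symmetric `T`. [folklore] -/
theorem dotProduct_mulVec_comm_of_isSymm (hT : T.IsSymm) (v w : Fin 3 → ℝ) :
    v ⬝ᵥ T *ᵥ w = w ⬝ᵥ T *ᵥ v := by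
  rw [dotProduct_mulVec, ← mulVec_transpose, hT.eq, dotProduct_comm]

/-- `T` preserves `n^⊥` for an eigenvector `n`: `⟨T v, n⟩ = λ ⟨v, n⟩`. [folklore] -/
theorem mulVec_dotProduct_eigenvector (hT : T.IsSymm) (hTn : T *ᵥ n = lam • n) (v : Fin 3 → ℝ) :
    (T *ᵥ v) ⬝ᵥ n = lam * (v ⬝ᵥ n) := by
  rw [dotProduct_comm, dotProduct_mulVec_comm_of_isSymm hT, hTn, dotProduct_smul, smul_eq_mul,
    dotProduct_comm]

/-! ### The orthogonal splitting `m = ⟨m, n⟩ n + v` -/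

/-- The component of `m` orthogonal to the unit vector `n`. [folklore] -/
theorem sub_smul_dotProduct_eq_zero (hn1 : n ⬝ᵥ n = 1) (m : Fin 3 → ℝ) :
    (m - (m ⬝ᵥ n) • n) ⬝ᵥ n = 0 := by
  rw [sub_dotProduct, smul_dotProduct, hn1, smul_eq_mul, mul_one, sub_self]

/-- **Splitting of the quadratic form**: `⟨m, T m⟩ = ⟨m, n⟩² λ + ⟨v, T v⟩` with
`v = m - ⟨m, n⟩ n ⊥ n`. [cite: Perutz2006, §2.3 (d)] -/
theorem quadratic_split (hT : T.IsSymm) (hn1 : n ⬝ᵥ n = 1) (hTn : T *ᵥ n = lam • n)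
    (m : Fin 3 → ℝ) :
    m ⬝ᵥ T *ᵥ m = (m ⬝ᵥ n) ^ 2 * lam +
      (m - (m ⬝ᵥ n) • n) ⬝ᵥ T *ᵥ (m - (m ⬝ᵥ n) • n) := by
  set a : ℝ := m ⬝ᵥ n with ha
  set v : Fin 3 → ℝ := m - a • n with hv
  have hvn : v ⬝ᵥ n = 0 := by rw [hv, ha]; exact sub_smul_dotProduct_eq_zero hn1 m
  have hm : m = a • n + v := by rw [hv]; abel
  have hTv_n : (T *ᵥ v) ⬝ᵥ n = 0 := by
    rw [mulVec_dotProduct_eigenvector hT hTn, hvn, mul_zero]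
  have hn_Tv : n ⬝ᵥ T *ᵥ v = 0 := by rw [dotProduct_comm]; exact hTv_n
  have h1 : m ⬝ᵥ T *ᵥ m = (a • n + v) ⬝ᵥ T *ᵥ (a • n + v) := by rw [← hm]
  have hvn' : v ⬝ᵥ n = 0 := hvn
  rw [h1]
  simp only [mulVec_add, mulVec_smul, hTn, add_dotProduct, dotProduct_add, smul_dotProduct,
    dotProduct_smul, smul_eq_mul, hn1, hn_Tv, hvn', mul_zero, mul_one, add_zero, zero_add]
  ring

/-! ### Consequences of positivity on `n^⊥` -/

/-- **A negative vector has a non-zero `n`-component**: if `T > 0` on `n^⊥` and `⟨w, T w⟩ < 0`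
then `⟨w, n⟩ ≠ 0`. [cite: Perutz2006, §2.3 (d)] -/
theorem dotProduct_ne_zero_of_quadratic_neg (hn1 : n ⬝ᵥ n = 1)
    (hpos : ∀ v, v ⬝ᵥ n = 0 → 0 ≤ v ⬝ᵥ T *ᵥ v) {w : Fin 3 → ℝ}
    (hw : w ⬝ᵥ T *ᵥ w < 0) : w ⬝ᵥ n ≠ 0 := by
  intro h0
  have hv := hpos (w - (w ⬝ᵥ n) • n) (sub_smul_dotProduct_eq_zero hn1 w)
  rw [h0, zero_smul, sub_zero] at hv
  linarith

/-- **The negative eigenline is well defined**: if `T > 0` on `n^⊥` (strictly on non-zero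
vectors) then every eigenvector `m ≠ 0` of NEGATIVE eigenvalue `μ` is a multiple of `n`, and
`μ = λ`. [cite: Perutz2006, §2.3 (d)] -/
theorem eq_smul_of_mulVec_eq_smul_of_neg (hT : T.IsSymm) (hn1 : n ⬝ᵥ n = 1)
    (hTn : T *ᵥ n = lam • n) (hpos : ∀ v, v ⬝ᵥ n = 0 → v ≠ 0 → 0 < v ⬝ᵥ T *ᵥ v)
    {m : Fin 3 → ℝ} {μ : ℝ} (hm : T *ᵥ m = μ • m) (hμ : μ < 0) (hm0 : m ≠ 0) :
    m = (m ⬝ᵥ n) • n ∧ μ = lam := by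
  set a : ℝ := m ⬝ᵥ n with ha
  set v : Fin 3 → ℝ := m - a • n with hv
  have hvn : v ⬝ᵥ n = 0 := by rw [hv, ha]; exact sub_smul_dotProduct_eq_zero hn1 m
  have hmsplit : m = a • n + v := by rw [hv]; abel
  -- `T v = μ v`: compare `T m = μ m` with `T m = a λ n + T v`, using `T v ⊥ n`
  have hTv_n : (T *ᵥ v) ⬝ᵥ n = 0 := by
    rw [mulVec_dotProduct_eigenvector hT hTn, hvn, mul_zero]
  have hTm : T *ᵥ m = (a * lam) • n + T *ᵥ v := by
    rw [hmsplit, mulVec_add, mulVec_smul, hTn, smul_smul]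
  -- the `n`-component: `μ a = λ a`
  have hcomp_n : μ * a = lam * a := by
    have h1 := congrArg (fun x ↦ x ⬝ᵥ n) hm
    beta_reduce at h1
    rw [hTm, add_dotProduct, smul_dotProduct, hn1, hTv_n, smul_dotProduct, ← ha] at h1
    simp only [smul_eq_mul, mul_one, add_zero] at h1
    linarith
  -- the `n^⊥`-component: `T v = μ v`
  have hTv : T *ᵥ v = μ • v := by
    have h1 : T *ᵥ v = T *ᵥ m - (a * lam) • n := by rw [hTm]; abel
    rw [h1, hm, hmsplit, smul_add, smul_smul, hcomp_n]
    abel_nf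
    module
  -- hence `v = 0`
  have hv0 : v = 0 := by
    by_contra hv0
    have h1 := hpos v hvn hv0
    have h2 : v ⬝ᵥ T *ᵥ v = μ * (v ⬝ᵥ v) := by rw [hTv, dotProduct_smul, smul_eq_mul]
    have h3 : 0 < v ⬝ᵥ v :=
      lt_of_le_of_ne (Finset.sum_nonneg fun i _ ↦ mul_self_nonneg (v i))
        fun h ↦ hv0 (dotProduct_self_eq_zero.1 h.symm)
    have h4 : μ * (v ⬝ᵥ v) < 0 := mul_neg_of_neg_of_pos hμ h3
    linarith
  have hma : m = a • n := by rw [hmsplit, hv0, add_zero]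
  have ha0 : a ≠ 0 := by
    intro h; apply hm0; rw [hma, h, zero_smul]
  refine ⟨hma, ?_⟩
  have := hcomp_n
  field_simp at this
  linarith [mul_right_cancel₀ ha0 hcomp_n]

/-- **Simplicity of the negative eigenvalue, as injectivity of the linearised eigenvector
equation**: if `(T - λ) h = η n` and `⟨n, h⟩ = 0` then `h = 0` and `η = 0`.  This is the
non-degeneracy needed to continue `(n, λ)` smoothly in parameters by the implicit function theorem.
[cite: Perutz2006, §2.3 (d)] -/
theorem linearization_injective (hT : T.IsSymm) (hn1 : n ⬝ᵥ n = 1) (hTn : T *ᵥ n = lam • n)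
    (hlam : lam < 0) (hpos : ∀ v, v ⬝ᵥ n = 0 → v ≠ 0 → 0 < v ⬝ᵥ T *ᵥ v) {h : Fin 3 → ℝ} {η : ℝ}
    (h1 : T *ᵥ h - lam • h = η • n) (h2 : h ⬝ᵥ n = 0) : h = 0 ∧ η = 0 := by
  -- `η = ⟨n, (T - λ) h⟩ = ⟨(T - λ) n, h⟩ = 0`
  have hη : η = 0 := by
    have h3 := congrArg (fun x ↦ x ⬝ᵥ n) h1
    beta_reduce at h3
    rw [sub_dotProduct, mulVec_dotProduct_eigenvector hT hTn, h2, smul_dotProduct, h2,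
      smul_dotProduct, hn1] at h3
    simp only [mul_zero, smul_eq_mul, sub_self, mul_one] at h3
    exact h3.symm
  refine ⟨?_, hη⟩
  by_contra hh
  rw [hη, zero_smul, sub_eq_zero] at h1
  have := (eq_smul_of_mulVec_eq_smul_of_neg hT hn1 hTn hpos h1 hlam hh).1
  rw [h2, zero_smul] at this
  exact hh this

/-! ### The eigenvector signed by a negative vector -/

/-- **Existence of the signed negative unit eigenvector**: for a negative vector `w`
(`⟨w, T w⟩ < 0`), one of `± n` has positive inner product with `w`; it is a unit eigenvector of
eigenvalue `λ`. [cite: Perutz2006, §2.3 (d)] -/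
theorem exists_signed_negative_eigenvector (hn1 : n ⬝ᵥ n = 1)
    (hTn : T *ᵥ n = lam • n) (hpos : ∀ v, v ⬝ᵥ n = 0 → v ≠ 0 → 0 < v ⬝ᵥ T *ᵥ v)
    {w : Fin 3 → ℝ} (hw : w ⬝ᵥ T *ᵥ w < 0) :
    ∃ n' : Fin 3 → ℝ, (n' = n ∨ n' = -n) ∧ n' ⬝ᵥ n' = 1 ∧ T *ᵥ n' = lam • n' ∧ 0 < n' ⬝ᵥ w := by
  have hpos' : ∀ v, v ⬝ᵥ n = 0 → 0 ≤ v ⬝ᵥ T *ᵥ v := fun v hv ↦ by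
    by_cases h0 : v = 0
    · simp [h0]
    · exact (hpos v hv h0).le
  have hwn : w ⬝ᵥ n ≠ 0 := dotProduct_ne_zero_of_quadratic_neg hn1 hpos' hw
  rcases lt_or_gt_of_ne hwn with hlt | hgt
  · refine ⟨-n, Or.inr rfl, by simp [hn1], by rw [mulVec_neg, hTn, smul_neg], ?_⟩
    rw [neg_dotProduct, dotProduct_comm]; linarith
  · exact ⟨n, Or.inl rfl, hn1, hTn, by rwa [dotProduct_comm]⟩

/-- **Uniqueness of the signed negative unit eigenvector**: a unit eigenvector of NEGATIVE
eigenvalue with positive inner product against the negative vector `w` is determined (it is the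
`n'` of `exists_signed_negative_eigenvector`). [cite: Perutz2006, §2.3 (d)] -/
theorem signed_negative_eigenvector_unique (hT : T.IsSymm) (hn1 : n ⬝ᵥ n = 1)
    (hTn : T *ᵥ n = lam • n) (hpos : ∀ v, v ⬝ᵥ n = 0 → v ≠ 0 → 0 < v ⬝ᵥ T *ᵥ v)
    {w m₁ m₂ : Fin 3 → ℝ} {μ₁ μ₂ : ℝ}
    (h₁ : m₁ ⬝ᵥ m₁ = 1) (hT₁ : T *ᵥ m₁ = μ₁ • m₁) (hμ₁ : μ₁ < 0) (hw₁ : 0 < m₁ ⬝ᵥ w)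
    (h₂ : m₂ ⬝ᵥ m₂ = 1) (hT₂ : T *ᵥ m₂ = μ₂ • m₂) (hμ₂ : μ₂ < 0) (hw₂ : 0 < m₂ ⬝ᵥ w) :
    m₁ = m₂ ∧ μ₁ = lam ∧ μ₂ = lam := by
  have hm₁0 : m₁ ≠ 0 := fun h ↦ by rw [h, zero_dotProduct] at h₁; exact zero_ne_one h₁
  have hm₂0 : m₂ ≠ 0 := fun h ↦ by rw [h, zero_dotProduct] at h₂; exact zero_ne_one h₂
  obtain ⟨e₁, hμ₁'⟩ := eq_smul_of_mulVec_eq_smul_of_neg hT hn1 hTn hpos hT₁ hμ₁ hm₁0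
  obtain ⟨e₂, hμ₂'⟩ := eq_smul_of_mulVec_eq_smul_of_neg hT hn1 hTn hpos hT₂ hμ₂ hm₂0
  refine ⟨?_, hμ₁', hμ₂'⟩
  set a₁ : ℝ := m₁ ⬝ᵥ n with ha₁
  set a₂ : ℝ := m₂ ⬝ᵥ n with ha₂
  -- `a₁² = a₂² = 1`
  have hsq₁ : a₁ ^ 2 = 1 := by
    have h := h₁
    rw [e₁, smul_dotProduct, dotProduct_smul, hn1] at h
    simp only [smul_eq_mul, mul_one] at h
    nlinarith
  have hsq₂ : a₂ ^ 2 = 1 := by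
    have h := h₂
    rw [e₂, smul_dotProduct, dotProduct_smul, hn1] at h
    simp only [smul_eq_mul, mul_one] at h
    nlinarith
  -- both `a₁ ⟨n, w⟩ > 0` and `a₂ ⟨n, w⟩ > 0`, so `a₁` and `a₂` have the same sign
  have hs₁ : 0 < a₁ * (n ⬝ᵥ w) := by
    have h := hw₁; rw [e₁, smul_dotProduct, smul_eq_mul] at h; exact h
  have hs₂ : 0 < a₂ * (n ⬝ᵥ w) := by
    have h := hw₂; rw [e₂, smul_dotProduct, smul_eq_mul] at h; exact h
  have ha : a₁ = a₂ := by
    have hprod : 0 < a₁ * a₂ := by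
      have := mul_pos hs₁ hs₂
      nlinarith [sq_nonneg (n ⬝ᵥ w)]
    nlinarith [sq_nonneg (a₁ - a₂), sq_nonneg (a₁ + a₂)]
  rw [e₁, e₂, ha]

end Literature.Analysis.Matrix
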